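import Summits.QuantumFields.BalabanUV.T4Continuum.Support.NE9LinSizeEndRemSpecies
import Summits.QuantumFields.BalabanUV.T4Continuum.Support.NE9Lemma1CurveSpecies
import Summits.QuantumFields.BalabanUV.T4Continuum.Support.NE9DoubledChart

/-!
# NE9LinSizeEndCurSpecies — E5′-CUR: the d-currency torus END face of row NE9 AT THE CURVE SPECIES — the (1.23)-pieces of the
FIFTH-ORDER TAYLOR REMAINDER of an analytic old term ALONG THE ANALYTIC SLICE CURVES of [I] Lemma 4 (3.53) — ON THE ANALYTIC CLASS,
with the channel-side S-binders S2 / S5 (and the zero / locality / source / step-sum structure) DISCHARGED BY THE KERNEL, and the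
ray-species face E5′-REM (`NE9LinSizeEndRemSpecies`, p213078) RECOVERED as the literal special case `Dc := Dd.toCur` (cell
`pub-balaban`, T4-DAG §2 node U3 / §6 NE9; rung (B)+1 on a FIXED finite T⁴; NE9 formalisation crew row **(w21)-E5′** of the row
owner's l.9603 (LOCATED FINDING F-ne9p1g25-1), unit `b2b-balaban-t4-ne9-formalise-leaf-07` gen 5, INTENT CLAIMS.log l.9673;
composition BY NAME of this lineage's E5′-πG-CL `NE9LinSizeEndCPiece` (p212669) and doubled chart `NE9DoubledChart` (p213930) with
the row owner's curve-species part 2 `NE9Lemma1CurveSpecies` (t4-ne9-p1-g25, p213869); nothing of any import is modified, no END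
re-wired)

HONEST FRAMING (T4-DAG PAGE 1).  Rung (B)+1 = existence and uniqueness of the ε → 0 limit of gauge-invariant observables on a
FIXED finite torus T⁴ — NOT infinite volume, NOT a mass gap, NOT the Clay problem.  NE9 is a cell NEW ESTIMATE, NOT PRINTED and
NOT discharged here («NE9 ⇐ the named binders»).  What is kernel here is FORM-LEVEL: the species is the owner's `CurData.toC` —
the (1.23) contour functional of the fifth-order remainder of the complex old term along the displayed analytic SLICE CURVES
σ′ ↦ cur(t, s, σ)(σ′) (O-ne9p1g25-1: for non-abelian G the background map B ↦ U_j(□₀, exp iB) of [I] (3.30)/(3.37) is not linear,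
so (3.54)'s σ-disc is an analytic CURVE through the expansion point, a ray only in the abelian sub-case), on the doubled (re/im)
carriers — and its identification with Bałaban's actual (1.23)/(1.33) pieces is O-NE9-1 (NODE O), NOT claimed.  DISPLAYED (binders,
never asserted): the datum's admissibility `CurData.Admissible` ([I] Lemma 4 (3.53) p. 280 TYPE: ON THE CONTOURS every slice curve
is analytic on its σ′-disc of radius ϱ > 1 and maps it into the analyticity ball of its source; the GAIN ϱ⁻¹ ≤ c_dir·ℓ of
(3.54)–(3.55); radii; source discipline; G1 = [II] (1.25)); S1 `AdmissibleTerms E W (analyticClass R)` ([I] (1.18) p. 263 — TYPE);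
the additivity of the pieces in the old term ON THE ANALYTIC CLASS `PieceAdditiveOn (analyticClass R) Dc.toC` (linearity of
(1.23); crew row (w19), displayed here); the level counts `LevelCountsG` of [II] p. 8 on the species' index frame; `Factorises` /
`LastCouplingLipschitz` at `cpieceChannel Dc.toC`; and every activity / geometry / (A″) / (L‴) binder of E5′ VERBATIM.  0 `def`,
0 `sorry`; [I]/[II] locators are TYPE locators (ABSOLUTE RULE); `FlowStep.BetaPertH`, (B), (B^μ) do not occur.
HONEST DEPENDENCY (verbatim): continuum YM on T⁴ ⇐ BetaPertH ∧ nine spine estimates (0/9 proved); BetaPertH ⇐ (D1) ∧ (D4) ∧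
CAP+tail; G-an2-4 gates asym, D1 and NE2/3/4.

WHAT IS PROVED (kernel).
§1 **E5′-CUR `torus_termSize_ne9_and_fadingMemory_of_linSizeDischargers_curSpecies`** — E5′-πG-CL (p212669) at `P := Dc.toC`,
   `Adm := analyticClass Dc.R`, `κ₁ := Dc.κ₁`, `Kp := Dc.Kp c_dir` (= 64·c_dir⁵/r_k), `gain := (ℓ k j)⁵`, with S2 `AdmRestrict` ⇐
   `admRestrict_analyticClass`, `PieceZero`/`PieceLocal`/`CSrcScale` ⇐ `pieceZero_cur`/`pieceLocal_cur`/`csrcScale_cur`, S5's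
   per-piece bound `PieceBoundOnG (analyticClass R)` ⇐ **`pieceBoundOnG_cur`** (analyticity of the input on the ball + of the
   slice curve on its disc, iterated Schwarz on the COMPOSITE slice = (I.3.54)'s Cauchy estimate in σ′, + `B13Sect1Arith.bound_124`
   /`bound_125` — the owner's parts 1–2 of gen 25), `hKp`/`hgain` ⇐ `kp_nonneg`/`pow_nonneg` — ALL BY NAME.  Binder list = E5′-REM's
   (p213078 §1) token for token with `RemData`/`KpOf Dd c_dir` ↦ `CurData`/`Dc.Kp c_dir`.  Conclusion LITERALLY E5′-πG's / E5′-REM's: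
   `TermSize E W κ Nsz ∧ NE9 E W κ (prodModuli ℓ fun _ => μ) ∧ FadingMemory (ℓ/μ) μ (…)`, **`μ = ω + 4·lipbar·(a₁·e^{−a″(ν+1)})·c_Q`**.
   (The displayed species' own rate letter `ω := L⁻¹`, [II] p. 8 l. 9–10, is the instance `hω := inv_pos.mpr …` of §1, exactly as
   E5′-REM-π p213078 §2 — not restated.)
§2 CONSISTENCY (`example`; statement = E5′-REM §1's (p213078) plus the owner's displayed strict positivity `hpos` of the ray
   datum's direction bounds): the RAY sub-case re-derived from §1 at `Dc := Dd.toCur` — `RemData.toCur_toC : Dd.toCur.toC = Dd.toC`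
   (`rfl`), `RemData.Admissible.toCur`.  Nothing landed is lost; §1 generalises it to the curve species.
§3 **E5′-CUR-DBL `…_curSpecies_dbl`** — §1 AT THE DOUBLED CHART `dblChart Γ` of an ORDINARY torus cube chart `Γ : CubeChart C …`
   (this lineage's `NE9DoubledChart`, p213930, LOCATED FINDING F-ne9leaf07g5-1: the species live on the doubled carriers, the charts of
   record on the undoubled ones): the activity data are indexed by the cube families of `Γ`, the new term at a copy (X, b) is the
   localized cluster sum at X, and the two chart binders are asked of `Γ` ITSELF (`hXconn`, `hcmp : κ·C.d X ≤ a″·d(Γ.cubes X)`).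
DISGUISE TEST: one-history statements about a linear channel of ONE run at a FORM-level species; S5 is the fading SOURCE, not NE9;
nothing is asserted about Bałaban's 𝐇_k, U_j(□₀, exp iB), 𝔘^c_j or (1.33).

References (TYPE locators only; nothing printed is a hypothesis): T. Bałaban, CMP **109** (1987) [Balaban1987RG1] (0.23) p. 256,
(0.29)–(0.30) p. 258, (1.18) p. 263, (3.28)–(3.30) p. 276, (3.33)–(3.37) p. 277, Lemma 4 (3.53)–(3.55) p. 280; CMP **116** (1988)
[Balaban1988RG2Cluster] (1.22)–(1.29) pp. 7–8, (1.33)–(1.36) p. 9, (2.27) p. 18, (2.38) p. 20, (2.41) p. 21; R. Kotecký, D. Preiss,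
CMP **103** (1986) [KoteckyPreiss1986].
-/

noncomputable section

namespace Summit.QuantumFields.BalabanUV.T4Continuum.NE9LinSizeEndCurSpecies

open scoped BigOperators
open Metric Set MeasureTheory BoundedContinuousFunction
open Literature.Probability.LatticeModels
open Literature.MathematicalPhysics.QuantumFieldTheory
open Literature.MathematicalPhysics.QuantumFieldTheory.Balaban1983to89
open Literature.MathematicalPhysics.QuantumFieldTheory.Balaban1983to89.T4OutputRate
open Literature.MathematicalPhysics.QuantumFieldTheory.Balaban1983to89.T4ActivityLipschitz
open Literature.MathematicalPhysics.QuantumFieldTheory.Balaban1983to89.T4HistoryLipschitzRecursion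
open Literature.MathematicalPhysics.QuantumFieldTheory.Balaban1983to89.T4HistoryLipschitzOuter
open Literature.MathematicalPhysics.QuantumFieldTheory.Balaban1983to89.T4HistoryLipschitzActivity
open Literature.MathematicalPhysics.QuantumFieldTheory.Balaban1983to89.T4HistoryLipschitzEntropy
open Literature.MathematicalPhysics.QuantumFieldTheory.Balaban1983to89.T4HistoryLipschitzCubeGeometry
open Literature.MathematicalPhysics.QuantumFieldTheory.Balaban1983to89.T4HistoryLipschitzActivity (ClusterGeom)
open Literature.MathematicalPhysics.QuantumFieldTheory.Balaban1983to89.T4HistoryLipschitzSegment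
open Literature.MathematicalPhysics.QuantumFieldTheory.Balaban1983to89.T4HistoryLipschitzLinearSize
open Summit.QuantumFields.BalabanUV.T4Continuum.NE9Lemma1Counting
open Summit.QuantumFields.BalabanUV.T4Continuum.NE9Lemma1Gain
open Summit.QuantumFields.BalabanUV.T4Continuum.NE9Lemma1PieceClass
open Summit.QuantumFields.BalabanUV.T4Continuum.NE9ComplexEncoding (doubleCarriers)
open Summit.QuantumFields.BalabanUV.T4Continuum.NE9Lemma1RemainderSpecies
open Summit.QuantumFields.BalabanUV.T4Continuum.NE9Lemma1CurveSpecies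
open Summit.QuantumFields.BalabanUV.T4Continuum.NE9LinSizeEnd
open Summit.QuantumFields.BalabanUV.T4Continuum.NE9LinSizeEndCPiece
open Summit.QuantumFields.BalabanUV.T4Continuum.NE9LinSizeEndRemSpecies
open Summit.QuantumFields.BalabanUV.T4Continuum.NE9DoubledChart

variable {ν N : ℕ} {C : Carriers} {D : ℕ}
variable {Bg : Type} [NormedAddCommGroup Bg] [NormedSpace ℂ Bg] {Sp : Type*} [TopologicalSpace Sp] [MeasurableSpace Sp]
  [OpensMeasurableSpace Sp] {F : Type*} [Fintype F] {Ω : Type*} [MeasurableSpace Ω]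

/-! ## §1 E5′-CUR: E5′ at the curve species on the analytic class -/

section Species

/-- **E5′-CUR — E5′ AT THE CURVE SPECIES ON THE ANALYTIC CLASS (kernel composition BY NAME; crew row (w21)-E5′).**  This lineage's
E5′-πG-CL (`NE9LinSizeEndCPiece`) at `P := Dc.toC` — the owner's FORM-level CURVE species of gen 25: piece at the source (X, re/im) =
Re/Im of the (1.23) contour functional `curPiece e^{κ₁} r_k cubes (lift H X) 5 cur` of the FIFTH-ORDER Taylor remainder of the
complex old term ALONG THE ANALYTIC SLICE CURVES of [I] Lemma 4 (3.53) — and `Adm := analyticClass Dc.R`.  KERNEL (owner's parts 1–2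
of gen 25 BY NAME): S2 `AdmRestrict` (`admRestrict_analyticClass`), `PieceZero`/`PieceLocal`/`CSrcScale` (`pieceZero_cur`,
`pieceLocal_cur`, `csrcScale_cur`), and the S5 per-piece bound **`PieceBoundOnG (analyticClass R) Dc.toC κ κ₁ d₀ (Dc.Kp c_dir) (ℓ⁵)`**
(`pieceBoundOnG_cur`: (I.3.54)'s Cauchy estimate in σ′ on the composite slice + (1.24)/(1.25) bookkeeping).  DISPLAYED on the
channel side: the datum's admissibility `hD` (Lemma 4 TYPE: slice curves analytic on their discs of radii ϱ > 1 and INSIDE the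
analyticity ball on the contours; gain ϱ⁻¹ ≤ c_dir·ℓ; radii; G1), S1 `hAdm` (the renormalised terms are analytic, [I] (1.18)),
the pieces' additivity in the old term on the analytic class `hA` (crew row (w19)), the level counts `hLev` ([II] p. 8), letters;
every activity / geometry / (A″) / (L‴) binder of E5′ VERBATIM.  Conclusion: E5′-πG's root shape with rate letter
**`μ = ω + 4·lipbar·(a₁·e^{−a″(ν+1)})·c_Q`** — the SAME as E5′-REM's (the datum shape does not touch the letters).
[cite: Balaban1987RG1, (1.18) p.263, (3.30) p.276, (3.37) p.277, (3.53)-(3.54) p.280; Balaban1988RG2Cluster, (1.23)-(1.29) pp.7-8, (1.33) p.9, (2.27) p.18, (2.38) p.20, (2.41) p.21; KoteckyPreiss1986, (1)-(3)] -/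
theorem torus_termSize_ne9_and_fadingMemory_of_linSizeDischargers_curSpecies
    (Γ : CubeChart (doubleCarriers C) (Fin ν → ZMod N) (torusAdj ν N) D) {ι αi βi γi δ : Type} [DecidableEq δ]
    (Dc : CurData C Bg ι αi βi γi δ) {ℓr : ℕ → ℕ → ℝ} {cdir d0 : ℝ}
    {E : Functional (doubleCarriers C) Bg} {W : Set (ℕ → ℝ)}
    {Ψ : ℕ → ℝ → (ι → ℝ) → Bg → (doubleCarriers C).Dom → ℝ}
    {μ : ℕ → ℝ → Bg → Finset (Fin ν → ZMod N) → Measure Ω} {pre : ℕ → ℝ → Bg → Finset (Fin ν → ZMod N) → Ω → ℂ}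
    {c : ℕ → ℝ → Bg → Finset (Fin ν → ZMod N) → Ω → F → ℂ}
    {pt : ℕ → ℝ → Bg → Finset (Fin ν → ZMod N) → Ω → F → Sp} {β : ℕ → Sp → ℝ}
    {dom : ℕ → Finset (Fin ν → ZMod N) → F → Finset (Fin ν → ZMod N)}
    {lip ε' α4 : ℕ → ℝ} {a₁ a'' κ O1 cQ ω lipbar ℓ a a' : ℝ}
    {lam p₀ Nsz : ℕ → ℝ}
    (ρ : ℕ → (ι → ℝ) → (Sp →ᵇ ℂ))
    -- the CURVE SPECIES: its datum is admissible ([I] Lemma 4 (3.53) TYPE: analytic slice curves into the ball, ϱ > 1, gain,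
    -- radii, G1), the scale letter ℓ ≥ 0
    (hD : Dc.Admissible ℓr cdir d0) (hℓr : ∀ k j, 0 ≤ ℓr k j)
    -- S1 (the renormalised terms lie in the ANALYTIC class — [I] (1.18) p. 263, TYPE) and scale-zero freeness
    (h0 : ScaleZeroFree E W) (hAdm : AdmissibleTerms E W (analyticClass Dc.R))
    -- S3's remaining half: additivity of the (1.23)-pieces in the old term ON THE ANALYTIC CLASS (crew row (w19); displayed here)
    (hA : PieceAdditiveOn (analyticClass Dc.R) Dc.toC)
    -- the level counts of [II] p. 8 on the species' index frame, against `c_Q·ω^{k−j}` (displayed), and the letters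
    (hLev : LevelCountsG Dc.toC.frame κ Dc.κ₁ O1 cQ (fun k j => ℓr k j ^ 5) (agePow ω))
    (hO1 : 0 ≤ O1) (hcQ : 0 ≤ cQ) (hω : 0 < ω)
    -- E5′'s remaining recursion-side binders at `T := cpieceChannel Dc.toC`, `wt := weightOf Dc.toC.frame Dc.κ₁ d0 O1 (Dc.Kp cdir)`
    (hfac : Factorises E W (cpieceChannel Dc.toC) Ψ) (hlast : LastCouplingLipschitz E W (cpieceChannel Dc.toC) Ψ κ lam)
    (hρ : ∀ (k : ℕ) (Q Q' : ι → ℝ) (M : ℝ), (∀ y, |Q y - Q' y| ≤ weightOf Dc.toC.frame Dc.κ₁ d0 O1 (Dc.Kp cdir) k y * M) →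
      ‖ρ k Q - ρ k Q'‖ ≤ M)
    (hΨ : ∀ (k : ℕ) (s : ℝ) (Q Q' : ι → ℝ) (U : Bg) (X : (doubleCarriers C).Dom),
      Ψ k s Q U X - Ψ k s Q' U X =
        (Γ.geom.newTerm (Γ.geom.avgExpLinearAct μ pre fun k s U γ ω => evalFunctional (c k s U γ ω) (pt k s U γ ω))
            k s U X (ρ k Q) -
          Γ.geom.newTerm (Γ.geom.avgExpLinearAct μ pre fun k s U γ ω => evalFunctional (c k s U γ ω) (pt k s U γ ω))
            k s U X (ρ k Q')).re)
    (hexpl : ∀ g ∈ W, ∀ (k : ℕ) (Q : ι → ℝ) (U : Bg) (X : (doubleCarriers C).Dom), (doubleCarriers C).scale X = k + 1 →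
      |Ψ k (g k) Q U X -
          (Γ.geom.newTerm (Γ.geom.avgExpLinearAct μ pre fun k s U γ ω => evalFunctional (c k s U γ ω) (pt k s U γ ω))
            k (g k) U X (ρ k Q)).re| ≤ Real.exp (-(κ * (doubleCarriers C).d X)) * p₀ k)
    (hbase : ∀ g ∈ W, ∀ (U : Bg) (X : (doubleCarriers C).Dom), (doubleCarriers C).scale X = 0 →
      |E g U X| ≤ Real.exp (-(κ * (doubleCarriers C).d X)) * Nsz 0)
    (hNsucc : ∀ j, p₀ j + a₁ * Real.exp (-(a'' * (ν + 1))) ≤ Nsz (j + 1)) (hNnn : ∀ j, 0 ≤ Nsz j)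
    (hbox : ∀ (k : ℕ) (Q : ι → ℝ),
      (∀ y, |Q y| ≤ weightOf Dc.toC.frame Dc.κ₁ d0 O1 (Dc.Kp cdir) k y * sizeRadius (tauOfG cQ (agePow ω)) Nsz k) →
        ∀ x, ‖ρ k Q x‖ ≤ β k x)
    (hpre : ∀ k s U γ, AEStronglyMeasurable (pre k s U γ) (μ k s U γ))
    (hc : ∀ k s U γ Y, AEStronglyMeasurable (fun ω => c k s U γ ω Y) (μ k s U γ))
    (hpt : ∀ k s U γ Y, Measurable fun ω => pt k s U γ ω Y) (hlip : ∀ k, 0 < lip k) (hlipb : ∀ k, lip k ≤ lipbar)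
    (hint₀ : ∀ k s U γ, Integrable (fun ω => ‖pre k s U γ ω‖ * Real.exp (boxExponent c pt β k s U γ ω)) (μ k s U γ))
    (hmeet : ∀ k s U (γ : Finset (Fin ν → ZMod N)) ω Y, c k s U γ ω Y ≠ 0 → ∃ x ∈ γ, x ∈ dom k γ Y)
    (hα4 : ∀ k, 0 ≤ α4 k) (ha : (2:ℝ) ^ ν * Real.log 2 + Real.log (8 * ν) ≤ a)
    (hliplb : ∀ k, α4 k * 2 ^ (ν + 1 + 2 ^ ν) ≤ lip k)
    (hlin : ∀ k s U (γ : Finset (Fin ν → ZMod N)) ω Y,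
      ‖c k s U γ ω Y‖ ≤ α4 k * Real.exp (-(a * (linSize (dom k γ Y) : ℝ))))
    (hdomconn : ∀ k (γ : Finset (Fin ν → ZMod N)) Y, (dom k γ Y).Nonempty →
      ∃ b ∈ dom k γ Y, Polymer.IsConn (torusAdj ν N) (dom k γ Y) b)
    (hdominj : ∀ k (γ : Finset (Fin ν → ZMod N)), Set.InjOn (dom k γ) {Y | (dom k γ Y).Nonempty})
    (hXconn : ∀ X, ∃ b, Polymer.IsConn (torusAdj ν N) (Γ.cubes X) b)
    (hcmp : ∀ X, κ * (doubleCarriers C).d X ≤ a'' * (linSize (Γ.cubes X) : ℝ))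
    (hε' : ∀ k, 0 ≤ ε' k)
    (hdecayLin : ∀ g ∈ W, ∀ (k : ℕ) (U : Bg) (X : (doubleCarriers C).Dom), (doubleCarriers C).scale X = k + 1 → ∀ γ' ∈ Γ.vol X,
      ∫ ω, ‖pre k (g k) U γ' ω‖ * Real.exp (boxExponent c pt β k (g k) U γ' ω) ∂(μ k (g k) U γ') ≤
        ε' k * Real.exp (-(a' * (linSize γ' : ℝ))))
    (ha₁ : 0 ≤ a₁) (ha'' : 0 ≤ a'')
    (hrate : (2:ℝ) ^ ν * Real.log 2 + Real.log (8 * ν) ≤ a' - a'' - 2 ^ ν * (a₁ + Real.log 2))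
    (hsmall : ∀ k, ((D : ℝ) + 1) * (2 * ε' k) * Real.exp (a'' * (ν + 1) + 2 ^ ν * (a₁ + Real.log 2)) *
      2 ^ (ν + 1 + 2 ^ ν) ≤ a₁)
    (hℓ : 0 ≤ ℓ) (hlam : ∀ k, lam k ≤ ℓ) :
    TermSize E W κ Nsz ∧
      NE9 E W κ (prodModuli ℓ fun _ => ω + 4 * lipbar * (a₁ * Real.exp (-(a'' * (ν + 1)))) * cQ) ∧
        FadingMemory (ℓ / (ω + 4 * lipbar * (a₁ * Real.exp (-(a'' * (ν + 1)))) * cQ))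
          (ω + 4 * lipbar * (a₁ * Real.exp (-(a'' * (ν + 1)))) * cQ)
          (prodModuli ℓ fun _ => ω + 4 * lipbar * (a₁ * Real.exp (-(a'' * (ν + 1)))) * cQ) := by
  -- S2 and the S5 package of the CURVE species are KERNEL (owner's gen-25 parts 1–2): restriction-closure of the analytic class,
  -- zero/locality/source discipline of the piece form, the per-piece bound ON THE ANALYTIC CLASS from (I.3.54) + (1.24)/(1.25)
  exact torus_termSize_ne9_and_fadingMemory_of_linSizeDischargers_cpieceGain Γ Dc.toC ρ h0 hAdm (admRestrict_analyticClass Dc.R)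
    (pieceZero_cur Dc) (pieceLocal_cur Dc) (csrcScale_cur hD) hA (pieceBoundOnG_cur hD κ) hLev (kp_nonneg hD) hO1
    (fun k j => pow_nonneg (hℓr k j) 5) hcQ hω hfac hlast hρ hΨ hexpl hbase hNsucc hNnn hbox hpre hc hpt hlip hlipb hint₀ hmeet hα4
    ha hliplb hlin hdomconn hdominj hXconn hcmp hε' hdecayLin ha₁ ha'' hrate hsmall hℓ hlam

end Species

/-! ## §2 Consistency: E5′-REM (the RAY sub-case, p213078) is §1 at `Dc := Dd.toCur` -/

section Ray

/-- CONSISTENCY (an `example`; the statement is E5′-REM §1's — `NE9LinSizeEndRemSpecies.torus_termSize_ne9_and_fadingMemory_of_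
linSizeDischargers_remSpecies` (p213078) — PLUS the owner's displayed strict positivity `hpos` of the ray datum's direction bounds,
under which `RemData.Admissible.toCur` reads the ray binders as curve binders): the RAY sub-case re-derived from §1 at the curve
reading `Dd.toCur` — `RemData.toCur_toC : Dd.toCur.toC = Dd.toC`, `Dd.toCur.κ₁ = Dd.κ₁`, `Dd.toCur.R = Dd.R`,
`Dd.toCur.Kp c_dir = KpOf Dd c_dir`, all definitional.  Nothing landed is lost; §1 is the generalisation F-ne9p1g25-1 asks for. [folklore] -/
example (Γ : CubeChart (doubleCarriers C) (Fin ν → ZMod N) (torusAdj ν N) D) {ι αi βi γi δ : Type} [DecidableEq δ]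
    (Dd : RemData C Bg ι αi βi γi δ) {ℓr : ℕ → ℕ → ℝ} {cdir d0 : ℝ}
    {E : Functional (doubleCarriers C) Bg} {W : Set (ℕ → ℝ)}
    {Ψ : ℕ → ℝ → (ι → ℝ) → Bg → (doubleCarriers C).Dom → ℝ}
    {μ : ℕ → ℝ → Bg → Finset (Fin ν → ZMod N) → Measure Ω} {pre : ℕ → ℝ → Bg → Finset (Fin ν → ZMod N) → Ω → ℂ}
    {c : ℕ → ℝ → Bg → Finset (Fin ν → ZMod N) → Ω → F → ℂ}
    {pt : ℕ → ℝ → Bg → Finset (Fin ν → ZMod N) → Ω → F → Sp} {β : ℕ → Sp → ℝ}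
    {dom : ℕ → Finset (Fin ν → ZMod N) → F → Finset (Fin ν → ZMod N)}
    {lip ε' α4 : ℕ → ℝ} {a₁ a'' κ O1 cQ ω lipbar ℓ a a' : ℝ}
    {lam p₀ Nsz : ℕ → ℝ}
    (ρ : ℕ → (ι → ℝ) → (Sp →ᵇ ℂ))
    (hD : Dd.Admissible ℓr cdir d0) (hpos : ∀ k s y a b x, 0 < Dd.dirB k s y a b x) (hℓr : ∀ k j, 0 ≤ ℓr k j)
    (h0 : ScaleZeroFree E W) (hAdm : AdmissibleTerms E W (analyticClass Dd.R))
    (hA : PieceAdditiveOn (analyticClass Dd.R) Dd.toC)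
    (hLev : LevelCountsG Dd.toC.frame κ Dd.κ₁ O1 cQ (fun k j => ℓr k j ^ 5) (agePow ω))
    (hO1 : 0 ≤ O1) (hcQ : 0 ≤ cQ) (hω : 0 < ω)
    (hfac : Factorises E W (cpieceChannel Dd.toC) Ψ) (hlast : LastCouplingLipschitz E W (cpieceChannel Dd.toC) Ψ κ lam)
    (hρ : ∀ (k : ℕ) (Q Q' : ι → ℝ) (M : ℝ), (∀ y, |Q y - Q' y| ≤ weightOf Dd.toC.frame Dd.κ₁ d0 O1 (KpOf Dd cdir) k y * M) →
      ‖ρ k Q - ρ k Q'‖ ≤ M)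
    (hΨ : ∀ (k : ℕ) (s : ℝ) (Q Q' : ι → ℝ) (U : Bg) (X : (doubleCarriers C).Dom),
      Ψ k s Q U X - Ψ k s Q' U X =
        (Γ.geom.newTerm (Γ.geom.avgExpLinearAct μ pre fun k s U γ ω => evalFunctional (c k s U γ ω) (pt k s U γ ω))
            k s U X (ρ k Q) -
          Γ.geom.newTerm (Γ.geom.avgExpLinearAct μ pre fun k s U γ ω => evalFunctional (c k s U γ ω) (pt k s U γ ω))
            k s U X (ρ k Q')).re)
    (hexpl : ∀ g ∈ W, ∀ (k : ℕ) (Q : ι → ℝ) (U : Bg) (X : (doubleCarriers C).Dom), (doubleCarriers C).scale X = k + 1 →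
      |Ψ k (g k) Q U X -
          (Γ.geom.newTerm (Γ.geom.avgExpLinearAct μ pre fun k s U γ ω => evalFunctional (c k s U γ ω) (pt k s U γ ω))
            k (g k) U X (ρ k Q)).re| ≤ Real.exp (-(κ * (doubleCarriers C).d X)) * p₀ k)
    (hbase : ∀ g ∈ W, ∀ (U : Bg) (X : (doubleCarriers C).Dom), (doubleCarriers C).scale X = 0 →
      |E g U X| ≤ Real.exp (-(κ * (doubleCarriers C).d X)) * Nsz 0)
    (hNsucc : ∀ j, p₀ j + a₁ * Real.exp (-(a'' * (ν + 1))) ≤ Nsz (j + 1)) (hNnn : ∀ j, 0 ≤ Nsz j)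
    (hbox : ∀ (k : ℕ) (Q : ι → ℝ),
      (∀ y, |Q y| ≤ weightOf Dd.toC.frame Dd.κ₁ d0 O1 (KpOf Dd cdir) k y * sizeRadius (tauOfG cQ (agePow ω)) Nsz k) →
        ∀ x, ‖ρ k Q x‖ ≤ β k x)
    (hpre : ∀ k s U γ, AEStronglyMeasurable (pre k s U γ) (μ k s U γ))
    (hc : ∀ k s U γ Y, AEStronglyMeasurable (fun ω => c k s U γ ω Y) (μ k s U γ))
    (hpt : ∀ k s U γ Y, Measurable fun ω => pt k s U γ ω Y) (hlip : ∀ k, 0 < lip k) (hlipb : ∀ k, lip k ≤ lipbar)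
    (hint₀ : ∀ k s U γ, Integrable (fun ω => ‖pre k s U γ ω‖ * Real.exp (boxExponent c pt β k s U γ ω)) (μ k s U γ))
    (hmeet : ∀ k s U (γ : Finset (Fin ν → ZMod N)) ω Y, c k s U γ ω Y ≠ 0 → ∃ x ∈ γ, x ∈ dom k γ Y)
    (hα4 : ∀ k, 0 ≤ α4 k) (ha : (2:ℝ) ^ ν * Real.log 2 + Real.log (8 * ν) ≤ a)
    (hliplb : ∀ k, α4 k * 2 ^ (ν + 1 + 2 ^ ν) ≤ lip k)
    (hlin : ∀ k s U (γ : Finset (Fin ν → ZMod N)) ω Y,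
      ‖c k s U γ ω Y‖ ≤ α4 k * Real.exp (-(a * (linSize (dom k γ Y) : ℝ))))
    (hdomconn : ∀ k (γ : Finset (Fin ν → ZMod N)) Y, (dom k γ Y).Nonempty →
      ∃ b ∈ dom k γ Y, Polymer.IsConn (torusAdj ν N) (dom k γ Y) b)
    (hdominj : ∀ k (γ : Finset (Fin ν → ZMod N)), Set.InjOn (dom k γ) {Y | (dom k γ Y).Nonempty})
    (hXconn : ∀ X, ∃ b, Polymer.IsConn (torusAdj ν N) (Γ.cubes X) b)
    (hcmp : ∀ X, κ * (doubleCarriers C).d X ≤ a'' * (linSize (Γ.cubes X) : ℝ))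
    (hε' : ∀ k, 0 ≤ ε' k)
    (hdecayLin : ∀ g ∈ W, ∀ (k : ℕ) (U : Bg) (X : (doubleCarriers C).Dom), (doubleCarriers C).scale X = k + 1 → ∀ γ' ∈ Γ.vol X,
      ∫ ω, ‖pre k (g k) U γ' ω‖ * Real.exp (boxExponent c pt β k (g k) U γ' ω) ∂(μ k (g k) U γ') ≤
        ε' k * Real.exp (-(a' * (linSize γ' : ℝ))))
    (ha₁ : 0 ≤ a₁) (ha'' : 0 ≤ a'')
    (hrate : (2:ℝ) ^ ν * Real.log 2 + Real.log (8 * ν) ≤ a' - a'' - 2 ^ ν * (a₁ + Real.log 2))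
    (hsmall : ∀ k, ((D : ℝ) + 1) * (2 * ε' k) * Real.exp (a'' * (ν + 1) + 2 ^ ν * (a₁ + Real.log 2)) *
      2 ^ (ν + 1 + 2 ^ ν) ≤ a₁)
    (hℓ : 0 ≤ ℓ) (hlam : ∀ k, lam k ≤ ℓ) :
    TermSize E W κ Nsz ∧
      NE9 E W κ (prodModuli ℓ fun _ => ω + 4 * lipbar * (a₁ * Real.exp (-(a'' * (ν + 1)))) * cQ) ∧
        FadingMemory (ℓ / (ω + 4 * lipbar * (a₁ * Real.exp (-(a'' * (ν + 1)))) * cQ))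
          (ω + 4 * lipbar * (a₁ * Real.exp (-(a'' * (ν + 1)))) * cQ)
          (prodModuli ℓ fun _ => ω + 4 * lipbar * (a₁ * Real.exp (-(a'' * (ν + 1)))) * cQ) :=
  torus_termSize_ne9_and_fadingMemory_of_linSizeDischargers_curSpecies Γ Dd.toCur ρ (hD.toCur hpos) hℓr h0 hAdm hA hLev hO1 hcQ
    hω hfac hlast hρ hΨ hexpl hbase hNsucc hNnn hbox hpre hc hpt hlip hlipb hint₀ hmeet hα4 ha hliplb hlin hdomconn hdominj hXconn
    hcmp hε' hdecayLin ha₁ ha'' hrate hsmall hℓ hlam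

end Ray

/-! ## §3 E5′-CUR-DBL: the curve species at the doubled chart of an ordinary torus cube chart -/

section Doubled

/-- **E5′-CUR-DBL — §1 AT THE DOUBLED CHART OF AN ORDINARY TORUS CUBE CHART (kernel composition BY NAME).**  The curve species lives
on the Re/Im-doubled carriers; the charts the tree constructs (carriers of record, multi-scale chart, `torusChart`) live on the
undoubled ones (LOCATED FINDING F-ne9leaf07g5-1).  This is §1 at `Γ′ := dblChart Γ` (`NE9DoubledChart`, p213930) for an ORDINARY chart
`Γ : CubeChart C (Fin ν → ZMod N) (torusAdj ν N) D`: activity data on the cube families of `Γ`, `hΨ`/`hexpl` with the localized cluster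
sum at the DOMAIN `X.1` (`dblChart_newTerm`, definitional), `hdecayLin` over `Γ.vol X.1`, and the two chart binders asked of `Γ`
ITSELF — `hXconn : ∀ X : C.Dom, …(Γ.cubes X)…` ([I] p. 257) and `hcmp : ∀ X : C.Dom, κ·C.d X ≤ a″·d(Γ.cubes X)` ([II] (2.30) TYPE).
Conclusion LITERALLY §1's.  = `NE9DoubledChart.…_cpieceGain_dbl` at `P := Dc.toC` with the owner's `…_cur` lemmas BY NAME.
[cite: Balaban1987RG1, p.257, (1.18) p.263, (3.53)-(3.54) p.280; Balaban1988RG2Cluster, (1.23)-(1.29) pp.7-8, (2.13) p.14, (2.27) p.18, (2.30) p.18, (2.38) p.20, (2.41) p.21; KoteckyPreiss1986, (1)-(3)] -/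
theorem torus_termSize_ne9_and_fadingMemory_of_linSizeDischargers_curSpecies_dbl
    (Γ : CubeChart C (Fin ν → ZMod N) (torusAdj ν N) D) {ι αi βi γi δ : Type} [DecidableEq δ]
    (Dc : CurData C Bg ι αi βi γi δ) {ℓr : ℕ → ℕ → ℝ} {cdir d0 : ℝ}
    {E : Functional (doubleCarriers C) Bg} {W : Set (ℕ → ℝ)}
    {Ψ : ℕ → ℝ → (ι → ℝ) → Bg → (doubleCarriers C).Dom → ℝ}
    {μ : ℕ → ℝ → Bg → Finset (Fin ν → ZMod N) → Measure Ω} {pre : ℕ → ℝ → Bg → Finset (Fin ν → ZMod N) → Ω → ℂ}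
    {c : ℕ → ℝ → Bg → Finset (Fin ν → ZMod N) → Ω → F → ℂ}
    {pt : ℕ → ℝ → Bg → Finset (Fin ν → ZMod N) → Ω → F → Sp} {β : ℕ → Sp → ℝ}
    {dom : ℕ → Finset (Fin ν → ZMod N) → F → Finset (Fin ν → ZMod N)}
    {lip ε' α4 : ℕ → ℝ} {a₁ a'' κ O1 cQ ω lipbar ℓ a a' : ℝ}
    {lam p₀ Nsz : ℕ → ℝ}
    (ρ : ℕ → (ι → ℝ) → (Sp →ᵇ ℂ))
    (hD : Dc.Admissible ℓr cdir d0) (hℓr : ∀ k j, 0 ≤ ℓr k j)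
    (h0 : ScaleZeroFree E W) (hAdm : AdmissibleTerms E W (analyticClass Dc.R))
    (hA : PieceAdditiveOn (analyticClass Dc.R) Dc.toC)
    (hLev : LevelCountsG Dc.toC.frame κ Dc.κ₁ O1 cQ (fun k j => ℓr k j ^ 5) (agePow ω))
    (hO1 : 0 ≤ O1) (hcQ : 0 ≤ cQ) (hω : 0 < ω)
    (hfac : Factorises E W (cpieceChannel Dc.toC) Ψ) (hlast : LastCouplingLipschitz E W (cpieceChannel Dc.toC) Ψ κ lam)
    (hρ : ∀ (k : ℕ) (Q Q' : ι → ℝ) (M : ℝ), (∀ y, |Q y - Q' y| ≤ weightOf Dc.toC.frame Dc.κ₁ d0 O1 (Dc.Kp cdir) k y * M) →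
      ‖ρ k Q - ρ k Q'‖ ≤ M)
    -- the new term at a copy (X, b) = the localized cluster sum at the domain X.1 over `Γ.geom`
    (hΨ : ∀ (k : ℕ) (s : ℝ) (Q Q' : ι → ℝ) (U : Bg) (X : (doubleCarriers C).Dom),
      Ψ k s Q U X - Ψ k s Q' U X =
        (Γ.geom.newTerm (Γ.geom.avgExpLinearAct μ pre fun k s U γ ω => evalFunctional (c k s U γ ω) (pt k s U γ ω))
            k s U X.1 (ρ k Q) -
          Γ.geom.newTerm (Γ.geom.avgExpLinearAct μ pre fun k s U γ ω => evalFunctional (c k s U γ ω) (pt k s U γ ω))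
            k s U X.1 (ρ k Q')).re)
    (hexpl : ∀ g ∈ W, ∀ (k : ℕ) (Q : ι → ℝ) (U : Bg) (X : (doubleCarriers C).Dom), (doubleCarriers C).scale X = k + 1 →
      |Ψ k (g k) Q U X -
          (Γ.geom.newTerm (Γ.geom.avgExpLinearAct μ pre fun k s U γ ω => evalFunctional (c k s U γ ω) (pt k s U γ ω))
            k (g k) U X.1 (ρ k Q)).re| ≤ Real.exp (-(κ * (doubleCarriers C).d X)) * p₀ k)
    (hbase : ∀ g ∈ W, ∀ (U : Bg) (X : (doubleCarriers C).Dom), (doubleCarriers C).scale X = 0 →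
      |E g U X| ≤ Real.exp (-(κ * (doubleCarriers C).d X)) * Nsz 0)
    (hNsucc : ∀ j, p₀ j + a₁ * Real.exp (-(a'' * (ν + 1))) ≤ Nsz (j + 1)) (hNnn : ∀ j, 0 ≤ Nsz j)
    (hbox : ∀ (k : ℕ) (Q : ι → ℝ),
      (∀ y, |Q y| ≤ weightOf Dc.toC.frame Dc.κ₁ d0 O1 (Dc.Kp cdir) k y * sizeRadius (tauOfG cQ (agePow ω)) Nsz k) →
        ∀ x, ‖ρ k Q x‖ ≤ β k x)
    (hpre : ∀ k s U γ, AEStronglyMeasurable (pre k s U γ) (μ k s U γ))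
    (hc : ∀ k s U γ Y, AEStronglyMeasurable (fun ω => c k s U γ ω Y) (μ k s U γ))
    (hpt : ∀ k s U γ Y, Measurable fun ω => pt k s U γ ω Y) (hlip : ∀ k, 0 < lip k) (hlipb : ∀ k, lip k ≤ lipbar)
    (hint₀ : ∀ k s U γ, Integrable (fun ω => ‖pre k s U γ ω‖ * Real.exp (boxExponent c pt β k s U γ ω)) (μ k s U γ))
    (hmeet : ∀ k s U (γ : Finset (Fin ν → ZMod N)) ω Y, c k s U γ ω Y ≠ 0 → ∃ x ∈ γ, x ∈ dom k γ Y)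
    (hα4 : ∀ k, 0 ≤ α4 k) (ha : (2:ℝ) ^ ν * Real.log 2 + Real.log (8 * ν) ≤ a)
    (hliplb : ∀ k, α4 k * 2 ^ (ν + 1 + 2 ^ ν) ≤ lip k)
    (hlin : ∀ k s U (γ : Finset (Fin ν → ZMod N)) ω Y,
      ‖c k s U γ ω Y‖ ≤ α4 k * Real.exp (-(a * (linSize (dom k γ Y) : ℝ))))
    (hdomconn : ∀ k (γ : Finset (Fin ν → ZMod N)) Y, (dom k γ Y).Nonempty →
      ∃ b ∈ dom k γ Y, Polymer.IsConn (torusAdj ν N) (dom k γ Y) b)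
    (hdominj : ∀ k (γ : Finset (Fin ν → ZMod N)), Set.InjOn (dom k γ) {Y | (dom k γ Y).Nonempty})
    -- THE TWO CHART BINDERS, ASKED OF THE ORDINARY CHART `Γ`
    (hXconn : ∀ X : C.Dom, ∃ b, Polymer.IsConn (torusAdj ν N) (Γ.cubes X) b)
    (hcmp : ∀ X : C.Dom, κ * C.d X ≤ a'' * (linSize (Γ.cubes X) : ℝ))
    (hε' : ∀ k, 0 ≤ ε' k)
    (hdecayLin : ∀ g ∈ W, ∀ (k : ℕ) (U : Bg) (X : (doubleCarriers C).Dom), (doubleCarriers C).scale X = k + 1 →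
      ∀ γ' ∈ Γ.vol X.1,
      ∫ ω, ‖pre k (g k) U γ' ω‖ * Real.exp (boxExponent c pt β k (g k) U γ' ω) ∂(μ k (g k) U γ') ≤
        ε' k * Real.exp (-(a' * (linSize γ' : ℝ))))
    (ha₁ : 0 ≤ a₁) (ha'' : 0 ≤ a'')
    (hrate : (2:ℝ) ^ ν * Real.log 2 + Real.log (8 * ν) ≤ a' - a'' - 2 ^ ν * (a₁ + Real.log 2))
    (hsmall : ∀ k, ((D : ℝ) + 1) * (2 * ε' k) * Real.exp (a'' * (ν + 1) + 2 ^ ν * (a₁ + Real.log 2)) *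
      2 ^ (ν + 1 + 2 ^ ν) ≤ a₁)
    (hℓ : 0 ≤ ℓ) (hlam : ∀ k, lam k ≤ ℓ) :
    TermSize E W κ Nsz ∧
      NE9 E W κ (prodModuli ℓ fun _ => ω + 4 * lipbar * (a₁ * Real.exp (-(a'' * (ν + 1)))) * cQ) ∧
        FadingMemory (ℓ / (ω + 4 * lipbar * (a₁ * Real.exp (-(a'' * (ν + 1)))) * cQ))
          (ω + 4 * lipbar * (a₁ * Real.exp (-(a'' * (ν + 1)))) * cQ)
          (prodModuli ℓ fun _ => ω + 4 * lipbar * (a₁ * Real.exp (-(a'' * (ν + 1)))) * cQ) :=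
  torus_termSize_ne9_and_fadingMemory_of_linSizeDischargers_cpieceGain_dbl Γ Dc.toC ρ h0 hAdm (admRestrict_analyticClass Dc.R)
    (pieceZero_cur Dc) (pieceLocal_cur Dc) (csrcScale_cur hD) hA (pieceBoundOnG_cur hD κ) hLev (kp_nonneg hD) hO1
    (fun k j => pow_nonneg (hℓr k j) 5) hcQ hω hfac hlast hρ hΨ hexpl hbase hNsucc hNnn hbox hpre hc hpt hlip hlipb hint₀ hmeet hα4
    ha hliplb hlin hdomconn hdominj hXconn hcmp hε' hdecayLin ha₁ ha'' hrate hsmall hℓ hlam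

end Doubled

end Summit.QuantumFields.BalabanUV.T4Continuum.NE9LinSizeEndCurSpecies

end
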